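import Literature.Geometry.Kaehler.HolomorphicChainNormalChart
import Literature.Geometry.GeometricMeasureTheory.CurrentsPushforward

/-!
# Maps fixing the support of a holomorphic chain act trivially on its current

Let `T` be a holomorphic `p`-chain on `Ω ⊆ V` and `f : V → V'`… here `f : V → V` a `C¹` map with
`f = id` on (the image in `V` of) the support `|T|`. Then **`Df(x) = id` on the approximate tangent
space `Tan^{2p}(𝓗^{2p} ⌞ reg|T|, x)` at every carrier point** (`fderiv_apply_eq_self_of_eqOn_support`:
in a holomorphic chart `Ψ` at `x`, `f ∘ Ψ = Ψ`, so `Df ∘ DΨ = DΨ`, and the tangent space is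
`im DΨ`, `HolomorphicChain.exists_normalChart`). Consequently the push-forward along `f` of any
current of integration `[W, θ_T, ξ_T]` built from the chain's density and orientation on a
measurable `W ⊆ reg |T|` is the current itself
(`currentOfIntegration_pushforward_eq_self_of_eqOn_support`; generic form
`currentOfIntegration_pushforward_eq_self`). Used for the retractions onto the tangent cone in
King's theorem (`f_# [C] = [C]`).

Theorems only; no named facts.

## References

* H. Federer, *Geometric Measure Theory*, Springer 1969, 4.1.7, 4.1.28, 4.1.30 [Federer1969].
* R. Harvey, *Holomorphic chains and their boundaries*, PSPUM XXX.1 (1977), §2.1 [Harvey1977].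
-/

noncomputable section

open scoped Manifold Topology ENNReal Distributions ContDiff
open Set Filter Metric Function Module TopologicalSpace MeasureTheory

namespace Literature.Geometry.GeometricMeasureTheory

-- Nested operator-norm instances on (duals of) `V [⋀^Fin n]→L[ℝ] ℝ`.
set_option maxSynthPendingDepth 2

/-! ### Generic: push-forward along a map fixing the carrier and its frame -/

section Generic

variable {V : Type*} [NormedAddCommGroup V] [InnerProductSpace ℝ V] [FiniteDimensional ℝ V]
  [MeasurableSpace V] [BorelSpace V] {Ω : Opens V} {m : ℕ}

omit [FiniteDimensional ℝ V] in
/-- **`f_# [W, θ, ξ] = [W, θ, ξ]` when `f` fixes `W` pointwise and `Df` fixes the frame a.e.**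
(and the cutoff is `1` on `W`). [cite: Federer1969, 4.1.7, 4.1.30] -/
theorem currentOfIntegration_pushforward_eq_self {W : Set V} {θ : V → ℤ} {ξ : V → Fin m → V}
    (hW : MeasurableSet W)
    (hloc : LocallyIntegrableOn (fun x => (θ x : ℝ) • frameVector (ξ x)) (Ω : Set V)
      ((μHE[m] : Measure V).restrict W))
    (χ : 𝓓(Ω, ℝ)) (hχ : ∀ x ∈ W, χ x = 1) {f : V → V} (hf : ContDiff ℝ ∞ f)
    (hfix : ∀ x ∈ W, f x = x)
    (hD : ∀ᵐ x ∂((μHE[m] : Measure V).restrict W), ∀ i, fderiv ℝ f x (ξ x i) = ξ x i) :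
    (currentOfIntegration W θ ξ : Current Ω m).pushforward Ω χ hf = currentOfIntegration W θ ξ := by
  ext ψ
  rw [Current.pushforward_apply, currentOfIntegration_apply hloc, currentOfIntegration_apply hloc]
  refine setIntegral_congr_ae hW ?_
  filter_upwards [(ae_restrict_iff' hW).1 hD] with x hx hxW
  rw [TestForm.pullback_apply, hχ x hxW, one_smul, ContinuousAlternatingMap.compContinuousLinearMap_apply,
    hfix x hxW]
  congr 2
  funext i
  exact hx hxW i

end Generic

end Literature.Geometry.GeometricMeasureTheory

namespace Literature.Geometry.Kaehler

namespace HolomorphicChain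

open Literature.Geometry.GeometricMeasureTheory

-- Nested operator-norm instances on (duals of) `V [⋀^Fin n]→L[ℝ] ℝ`.
set_option maxSynthPendingDepth 2

universe u

variable {V : Type u} [NormedAddCommGroup V] [InnerProductSpace ℂ V] [FiniteDimensional ℂ V]
  [MeasurableSpace V] [BorelSpace V] {Ω : Opens V} {p : ℕ}

/-- **A `C¹` map equal to the identity on `|T|` has `Df = id` on the approximate tangent spaces
of the carrier.** [cite: Federer1969, 3.1.19, 4.1.30; Harvey1977, §2.1] -/
theorem fderiv_apply_eq_self_of_eqOn_support (T : HolomorphicChain 𝓘(ℂ, V) Ω p) {f : V → V}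
    (hf : ContDiff ℝ 1 f) (hfix : ∀ x ∈ ((↑) : Ω → V) '' T.support, f x = x) {x : V}
    (hx : x ∈ T.carrier) {v : V}
    (hv : v ∈ approxTangentCone (2 * p) ((μHE[2 * p] : Measure V).restrict T.carrier) x) :
    fderiv ℝ f x v = v := by
  obtain ⟨K, π₁, ρ, Ψ, N, -, -, hρ, -, -, -, hΨd, hΨ0, -, -, hΨc, -, hcone, -⟩ :=
    T.exists_normalChart hx
  -- `f ∘ Ψ = Ψ` on the ball
  have hfΨ : ∀ k ∈ ball (0 : K) ρ, f (Ψ k) = Ψ k := fun k hk =>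
    hfix _ (T.carrier_subset_image_support (hΨc k hk))
  -- differentiate at `0`
  have hΨdiff : DifferentiableAt ℂ Ψ 0 := (hΨd 0 (mem_ball_self hρ)).differentiableAt
    (isOpen_ball.mem_nhds (mem_ball_self hρ))
  have hΨdiffR : DifferentiableAt ℝ Ψ 0 := hΨdiff.restrictScalars ℝ
  have hfd : DifferentiableAt ℝ f (Ψ 0) := (hf.differentiable one_ne_zero) _
  have hcomp : fderiv ℝ (f ∘ Ψ) 0 = (fderiv ℝ f (Ψ 0)).comp (fderiv ℝ Ψ 0) := fderiv_comp 0 hfd hΨdiffR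
  have heq : fderiv ℝ (f ∘ Ψ) 0 = fderiv ℝ Ψ 0 := by
    refine Filter.EventuallyEq.fderiv_eq ?_
    filter_upwards [isOpen_ball.mem_nhds (mem_ball_self hρ)] with k hk using hfΨ k hk
  -- `v ∈ im DΨ(0)`
  have hv' : v ∈ Set.range (fderiv ℂ Ψ 0) := by rw [← hcone 0 (mem_ball_self hρ), hΨ0]; exact hv
  obtain ⟨w, rfl⟩ := hv'
  have h1 : fderiv ℝ Ψ 0 w = fderiv ℂ Ψ 0 w := by
    rw [hΨdiff.fderiv_restrictScalars ℝ]; rfl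
  have := congrArg (fun L : K →L[ℝ] V => L w) hcomp
  simp only [heq, ContinuousLinearMap.comp_apply] at this
  rw [hΨ0] at this
  rw [← h1]
  exact this.symm

/-- **The push-forward of a sub-current of a holomorphic chain along a map fixing the support is
the current itself**: for a measurable `W ⊆ reg |T|` with `[W, θ_T, ξ_T]` of locally integrable
density, `f` smooth with `f = id` on `|T|` and a cutoff `χ = 1` on `W`,
`f_# [W, θ_T, ξ_T] = [W, θ_T, ξ_T]`. [cite: Federer1969, 4.1.30; Harvey1977, §2.1] -/
theorem currentOfIntegration_pushforward_eq_self_of_eqOn_support (T : HolomorphicChain 𝓘(ℂ, V) Ω p)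
    {Ω' : Opens V} {W : Set V} (hW : MeasurableSet W) (hWc : W ⊆ T.carrier)
    (hloc : letI : InnerProductSpace ℝ V := InnerProductSpace.complexToReal
      LocallyIntegrableOn (fun x => (T.density x : ℝ) • frameVector (T.orientationFrame x))
        (Ω' : Set V) ((μHE[2 * p] : Measure V).restrict W))
    (χ : 𝓓(Ω', ℝ)) (hχ : ∀ x ∈ W, χ x = 1) {f : V → V} (hf : ContDiff ℝ ∞ f)
    (hfix : ∀ x ∈ ((↑) : Ω → V) '' T.support, f x = x) :
    letI : InnerProductSpace ℝ V := InnerProductSpace.complexToReal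
    (currentOfIntegration W T.density T.orientationFrame : Current Ω' (2 * p)).pushforward Ω' χ hf =
      currentOfIntegration W T.density T.orientationFrame := by
  letI : InnerProductSpace ℝ V := InnerProductSpace.complexToReal
  refine currentOfIntegration_pushforward_eq_self hW hloc χ hχ hf
    (fun x hx => hfix x (T.carrier_subset_image_support (hWc hx))) ?_
  rw [ae_restrict_iff' hW]
  refine Eventually.of_forall fun x hx i => ?_
  have hxc := hWc hx
  have hspan := (T.orientationFrame_orthonormal_span_eq hxc).2
  refine T.fderiv_apply_eq_self_of_eqOn_support (hf.of_le (by simp)) hfix hxc ?_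
  rw [← hspan]
  exact Submodule.subset_span (mem_range_self i)

end HolomorphicChain

end Literature.Geometry.Kaehler
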